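import Literature.AlgebraicGeometry.Resolution.Hironaka1970NearPointInvariantCone
import Literature.AlgebraicGeometry.Resolution.PermissibleCentres
import Literature.RingTheory.HilbertSamuel.NormalConeFibreIdeal
import HarnessLib

/-!
# Hironaka 1970 (J. Math. Kyoto Univ. 10), THEOREM IV — for the blow-up of an ARBITRARY permissible
# centre `D ∋ x`: at a near point the cone `C_{X,D,x}` has its ideal generated by elements of
# `U_{g,x'}` — STATEMENT ONLY (fact F-51′ of cell res-hironaka, crux chain w42, T7b)

Source: H. Hironaka, *Certain numerical characters of singularities*, J. Math. Kyoto Univ. 10 (1970)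
151–187 [`Hironaka1970NumericalCharacters`], held text `paper:hironaka1970-certain-numerical-characters-singularities`
(PDF page `k` = printed p. `150 + k`; OCR). Companion of `Hironaka1970NearPointInvariantCone.lean`,
which types the POINT-centre case `D = {x}` (`Hironaka1970_thmIV_point`, fact F-51); this file types the
theorem for a general permissible centre, as printed. Read on the page:

> (p. 155 L23–33, the standing data (2.1)–(2.2)) «let us consider `x ∈ D ⊂ X ⊂ Z`, where `Z` is a regular
> scheme, `X` a closed subscheme of `Z` and `D` a closed regular subscheme of `X` such that (2.1) `X` is
> normally flat along `D` at the point `x`. Our basic geometric object then is the following [diagram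
> (2.2): `x' ∈ X' ⊂ Z'` over `x ∈ X ⊂ Z`] where `g` (resp. `f`) is the blowing-up with center `D`, … and
> `x'` is any point of `f⁻¹(x)`.»
> (p. 156 L11–12) «**THEOREM IV.** If the equality of TH III holds, then the tangential cone `C_{X,x}` is
> invariant by the subgroup `B_{g,x'}` of `T_{Z,x}`.» (TH III, p. 156 L7–10: the «near» condition, = CJS
> LNM 2270 Thm. 3.10 (2)+(6) and Def. 3.13 (1) «`x'` is near to `x` if `H_{X'}(x') = H_X(x)`».)
> (p. 152 L24 – p. 153 L3) «There is a natural structure of graded `𝒪_D`-algebra in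
> `⊕_d (I_{X,D})^d/(I_{X,D})^{d+1}` which we denote by `gr_D(X)`. We write `C_{X,D}` for `Spec(gr_D(X))`
> and call it the normal cone of `X` along `D` … The fibre of the normal cone above a point `x ∈ D` will
> be denoted by `C_{X,D,x}`.»
> (p. 168 (13.1) L22–31) «choose a regular system of parameters of `𝒪_{Z,x}`, say
> `(x_0, x_1, …, x_r, y_1, …, y_s)` such that `(x_0, …, x_r)𝒪_{Z,x} = I_{Z,D,x}` and
> `(x_0)𝒪_{Z',x'} = I_{Z,D,x}𝒪_{Z',x'}`. Let `K` be the residue field of `𝒪_{Z,x}` … so that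
> `gr_x(Z) = K[X_0, …, X_r, Y_1, …, Y_s]` and `gr_x(Z,D) = K[X_0, …, X_r]`. `U_{g,x'}` is then the
> graded `K`-subalgebra of the polynomial ring `K[X]` whose homogeneous part of degree `d` is
> `{φ ∈ K[X]_d | ν_{x'}(φ/X_0^d) ≥ d}`, where `g⁻¹(x)` is identified with `Proj(K[X])` and `x'` is viewed
> as a point of `Proj(K[X])`.»
> (p. 169 last lines – p. 170 L9) «Let `I` be the homogeneous ideal of the cone `C_{X,D,x}` in `K[X]` …
> By definition, `C_{X,x}` is invariant by `B_{g,x'}` if and only if the ideal of `C_{X,x}` in `gr_x(Z)`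
> is generated by elements of `U_{g,x'}`. By the normal flatness assumption (2.1), the ideal of `C_{X,x}`
> in `gr_x(Z)` is generated by the ideal of `C_{X,D,x}` in `gr_x(Z,D) = K[X]`. It follows that (14.3)
> `C_{X,x}` is invariant by `B_{g,x'}` if and only if there exists a standard base of the ideal `I`
> consisting of elements in `U_{g,x'}`.»

## What is typed (general permissible centre; cell res-hironaka W4.2 consumer shape, companion of
## `CossartJannsenSaito2020.CossartJannsenSaito2020_thm_3_14`)

RENDERING CHOICES (to be read with the statement; they are those of F-51 with `𝔪_x` replaced by the
stalk ideal `I_{D,x} ⊆ 𝒪_{X,x}` of the centre):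

(a) The regular ambient `Z` of (2.2) is taken, through the (completed) local ring, of codimension
`codim_x(D ⊂ Z) = r + 1 = μ(I_{D,x})`, the minimal number of generators of the ideal `I_{D,x}` of `D`
in `𝒪_{X,x}` (always achievable locally: if an equation of `X` in `Z` is part of a minimal base of
`I_{Z,D,x}`, it is part of a regular system of parameters and may be cut away), so that
`gr_x(Z,D) = K[X_0, …, X_r] = Sym_{k(x)}(I_{D,x}/𝔪_x I_{D,x})` on a minimal system of generators
`g_0, …, g_r` of `I_{D,x}` and «the homogeneous ideal `I` of the cone `C_{X,D,x}` in `K[X]`» is the tree's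
`normalConeIdeal g` (`Literature/RingTheory/HilbertSamuel/NormalConeFibreIdeal.lean`: the forms `F` of
degree `d` with `F(g) ∈ 𝔪_x I_{D,x}^d`, i.e. the kernel of `K[X] ↠ gr_{I_{D,x}}(𝒪_{X,x}) ⊗ k(x)`);
(†) «`X` closed in a regular `Z`» is replaced by the tree's standing hypothesis `Scheme.IsExcellent X`
and «`D` regular, (2.1)» by the tree's permissibility of the centre (`IdealSheafData.IsPermissible`, CJS
Def. 3.1 (2): regular, normally flat, no component — at every point of `D`), exactly as in
`CossartJannsenSaito2020_thm_3_14`; the THEOREM itself has no characteristic and no residue-field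
hypothesis.
(b) «The equality of TH III» is typed as CJS's «near»: `H^N_{X'}(x') = H^N_X(x)` for the tree's
`Scheme.hsFun · N`, `N ≥ dim X` (CJS Thm. 3.10 (2)+(6) identify it with Hironaka's `ν*`-equality).
(c) The conclusion is the (14.3)-weak form «`I` is generated by elements of `U_{g,x'}`» (from p. 170
L3–5: the ideal of `C_{X,x}` in `K[X,Y]` is `I · K[X,Y]` and is generated by elements `u_j` of
`U_{g,x'} ⊆ K[X]`; then `u_j ∈ I · K[X,Y] ∩ K[X] = I` and, setting `Y = 0`, the `u_j` generate `I`) rather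
than the standard-base form; `U_{g,x'}` is the multiplicity algebra `HironakaScheme.multAlgebra`
(Mizutani's `U(𝔭)`, `HironakaGroupSchemeMultiplicity.lean`) of the homogeneous prime `𝔭_{x'} = chartPrime`
of the point `x'` of `g⁻¹(x) = ℙ(N_{Z,D,x}) = Proj K[X]` (`ProjDirectrixChart.lean`), in the chart
`(t, u)` of the exceptional divisor at `x'` of (13.1): `I_{D,x}𝒪_{X',x'} = (t)`, `t` a non-zero-divisor,
`π^♯(g_i) = u_i t` (Hironaka normalises `t = π^♯(x_0)`; any local equation gives the same `𝔭_{x'}`).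
NO additive group scheme is typed (none is needed for this sentence of the source).

For `D = {x}` a closed point, `I_{D,x} = 𝔪_x` (`stalkIdeal_vanishingIdeal_singleton`) and
`normalConeIdeal g = tangentConeIdeal g _` (`normalConeIdeal_eq_tangentConeIdeal`): the statement
specialises to `Hironaka1970_thmIV_point` (F-51). Statement only (`def … : Prop`); consumers take
`(h : Hironaka1970_thmIV)`. NOT a statement of H. Hironaka's 2017 manuscript; a theorem of the
refereed 1970 paper, typed as a fact for cell res-hironaka's fact desk, for the OURS discharge of the
general-centre directrix binder `Theorem314_geomDir` (T7b). AI-typed; AI review is weaker than expert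
review. -- TODO(general form): the standard-base form (14.3); normal flatness at `x` only.

## References

* H. Hironaka, J. Math. Kyoto Univ. 10 (1970): §2 p. 152–153 (normal cone), (2.1)–(2.2) p. 155,
  TH III–IV p. 156, (13.1)–(13.2) p. 168, p. 169 last lines, (14.3) p. 170 L1–9.
  [Hironaka1970NumericalCharacters]
* V. Cossart, U. Jannsen, S. Saito, LNM 2270 (2020): Def. 3.1, Thm. 3.10 (2)(6) p. 47, Def. 3.13 (1)
  p. 50, Thm. 3.14 and its proof p. 51–52 («by the second reference there is a certain canonical
  subgroup scheme `B_{P,x'}` … the action of `B_{P,x'}` on `V` respects `C_x(X)/T_x(D)` if `x'` is near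
  to `x`»). [CossartJannsenSaito2020]
-/

noncomputable section

open CategoryTheory AlgebraicGeometry TopologicalSpace IsLocalRing
open Literature.RingTheory.HilbertSamuel

namespace Literature.AlgebraicGeometry.Resolution

universe u

/-- NAMED FACT — **Hironaka 1970 (Kyoto), THEOREM IV (p. 156 L11–12) for the blow-up of an arbitrary
permissible centre `D`, in the form p. 170 L3–9**: «If the equality of TH III holds [`x'` near to `x`:
`H_{X'}(x') = H_X(x)`], then the tangential cone `C_{X,x}` is invariant by the subgroup `B_{g,x'}` of
`T_{Z,x}`», where «by definition, `C_{X,x}` is invariant by `B_{g,x'}` if and only if the ideal of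
`C_{X,x}` in `gr_x(Z)` is generated by elements of `U_{g,x'}`. By the normal flatness assumption (2.1),
the ideal of `C_{X,x}` in `gr_x(Z)` is generated by the ideal of `C_{X,D,x}` in `gr_x(Z,D) = K[X]`»,
`U_{g,x'} = {φ ∈ K[X]_d | ν_{x'}(φ/X_0^d) ≥ d}_d` (p. 168 L28–31). Typed (module docstring (a)–(c)): for
`X` locally noetherian and excellent, `D` a permissible centre, `π : X' ⟶ X` a blow-up in `D`,
`N ≥ dim X`, `x ∈ D`, `x'` over `x` with `H^N_{X'}(x') = H^N_X(x)`; for every minimal system of generators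
`g_1, …, g_m` of the stalk ideal `I_{D,x}` (`m = μ(I_{D,x})`) and every chart `(t, u)` of the exceptional
divisor at `x'` (`t` a non-zero-divisor of `𝒪_{X',x'}` with `I_{D,x}𝒪_{X',x'} = (t)` and `π^♯(g_i) = u_i t`):
the ideal `J_D = normalConeIdeal g ⊆ k(x)[X_1, …, X_m]` of the cone `C_{X,D,x}` is generated by its
elements lying in the algebra `U(𝔭_{x'})` of the homogeneous prime `𝔭_{x'}` of the point `x'` of
`ℙ(N_{D,x}) = Proj k(x)[X]`. The case `D = {x}` is `Hironaka1970_thmIV_point`. Statement only; users take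
`(h : Hironaka1970_thmIV)`.
[cite: Hironaka1970NumericalCharacters, THEOREM IV p. 156 L11–12; p. 170 L1–9 (14.3); §2 p. 152–153; (2.1)–(2.2) p. 155 L23–33; (13.1)–(13.2) p. 168 L22–38; CossartJannsenSaito2020, Thm. 3.10 (2)(6) p. 47, Def. 3.13 (1) p. 50, proof of Thm. 3.14 p. 51 L13 – p. 52 L6] -/
def Hironaka1970_thmIV : Prop :=
  ∀ (X X' : Scheme.{u}) [IsLocallyNoetherian X] (π : X' ⟶ X) (D : X.IdealSheafData) (N : ℕ)
    (x' : X') (x : X),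
    Scheme.IsExcellent X → IdealSheafData.IsPermissible D → IsBlowup π D →
    topologicalKrullDim ↥X ≤ (N : WithBot ℕ∞) → π.base x' = x → x ∈ (D.support : Set X) →
    Scheme.hsFun X' N x' = Scheme.hsFun X N x →
    ∀ (m : ℕ) (g : Fin m → X.presheaf.stalk (π.base x'))
      (t : X'.presheaf.stalk x') (u : Fin m → X'.presheaf.stalk x'),
      Ideal.span (Set.range g) = stalkIdeal D (π.base x') →
      (stalkIdeal D (π.base x')).spanFinrank = m →
      t ∈ nonZeroDivisors (X'.presheaf.stalk x') →
      (stalkIdeal D (π.base x')).map (π.stalkMap x').hom = Ideal.span {t} →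
      (∀ i, (π.stalkMap x').hom (g i) = u i * t) →
        normalConeIdeal g ≤ Ideal.span
          ((normalConeIdeal g : Set (MvPolynomial (Fin m) (ResidueField (X.presheaf.stalk (π.base x'))))) ∩
            (HironakaScheme.multAlgebra (ResidueField (X.presheaf.stalk (π.base x')))
              (_root_.Literature.RingTheory.HilbertSamuel.chartPrime (π.stalkMap x').hom u) :
              Set (MvPolynomial (Fin m) (ResidueField (X.presheaf.stalk (π.base x'))))))

end Literature.AlgebraicGeometry.Resolution

end
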